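/-
Copyright (c) 2026 the pub-hodgecm-mathlib formalisation cell (harness21).  Prover seat hodgecm-mathlib-LH4-p10 (g9), Track B ∕ R90-TF, h413 = `stmt-HodgeConjecture-24833`,
R90-TF section S8 «ContSpec-n½» (S8 dealer R90-CS-plan (g3) S8-R226, via chair K2-lead VALVE 20 (u); RES-INT census of K2E1-p10 (g6) `K2/K2E1-p10/g6/CENSUS-RES-INT-Ma.K2E1-p10-g6.md`
LINE 6): the intertwining coordinates `M(z)` — the SECOND CONSTANT-TERM COEFFICIENT of the continued Eisenstein family — are `G(𝔸)`-EQUIVARIANT AS AN OPERATOR along a finite flat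
re-expansion, on the whole slit half-plane, and so is their residue `M₋₁` at `3∕2`.  HYPOTHESIS-FIRST on ESTATE T's exports (continued family, continuity, joint local bound) and on the
ℓ-CT package's by-value letters (★ `ctPackage_of_scalarRoad`).
-/
import Summits.HodgeConjecture.HodgeConjecture.Theorems.R90S8ResGMidAtomTransOfFlatReexpansionU3   -- ★ (T_f) FILE B (C133-p02): `eisensteinSeriesU_finset_sum`; brings ★ `hSUM_of_unitary`, ★ `eqOn_reSlit_of_eqOn_re_gt`, ★ `eisensteinSeriesU_rightTranslation`, ★ D1 ∕ pair DEFS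
import Summits.HodgeConjecture.HodgeConjecture.Theorems.K2E1ChiConstantTermHolomorphicCMThree     -- ★ `differentiableOn_borelConstantTerm_slitPlane_cm_three` (the continued constant term is holomorphic on the slit half-plane)
import HarnessLib

/-!
# S8 RES-INT line 6 — `R90S8ResidueOperatorEquivarianceU3`: `M(z)(g·φ) = g·(M(z)φ)` AND `M₋₁(g·φ) = g·(M₋₁φ)` ALONG A FINITE FLAT RE-EXPANSION

Track B ∕ R90-TF, crux h413 = `stmt-HodgeConjecture-24833`, route of record `HCCMUnconditional`; cell `hodgecm-mathlib`, R90-TF section S8 «ContSpec-n½ ∕ ResidualSpectrum», RES-INT road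
(M-a) line 6 (consumer: K2E1-p10 (g6)'s line-7 packaging `R(g_f) ∘ Res = Res ∘ g_f`, `ker Res = ker M₋₁`).  THEOREMS ONLY (no `def`, no `instance`, no `notation`, no named-fact hypothesis,
no `sorry`; default heartbeats); lane `--supports stmt-HodgeConjecture-24833 --as helper` (count-neutral).  CLOSES NO SOCKET.

THE MATHEMATICS ([MoeglinWaldspurger1995] II.1.7, IV.1.9–IV.1.11; [Langlands1976] §7; [Conway1978] IV §3).  In the ℓ-CT currency the intertwining coordinate of a section `φ` of
`I(χ, z)` is the second coefficient `ψ_z = M(z)φ` of the Borel constant term of its continued Eisenstein family: `(Ec z)_B(y) = φ(y)·H(y)^z + ψ_z(y)·H(y)^{2−z}` on `{1 < Re} ∖ Sp`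
(★ `ctPackage_of_scalarRoad`, SHAPE by definition), and `M₋₁φ = ρψ` is its residue `(z − 3∕2)·ψ_z → ρψ`.  Let `g ∈ G(𝔸)` and suppose the translated flat family re-expands POINTWISE as
`flat(φ, z)(y g) = Σᵢ cᵢ^z flat(ψᵢ, z)(y)` (`cᵢ > 0`; ★ (T_f) FILE A's shape `hdec`) with pieces `ψᵢ` in the level-free pair-section space carrying continuation data `(Ecᵢ, Spᵢ)`.
(a) For `2 < Re z`: `Ec z (y g) = Σᵢ cᵢ^z Ecᵢ z y` for EVERY `y` (★ `eisensteinSeriesU_rightTranslation`, ★ `eisensteinSeriesU_finset_sum`, Godement summability ★ `hSUM_of_unitary`), so —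
the constant term commuting with right translations (`(F)_B(x g) = (r(g)F)_B(x)`, `mul_assoc` under `∫_𝓕`) and being linear on continuous integrands (`𝓕` relatively compact) —
`(Ec z)_B(x g) = Σᵢ cᵢ^z (Ecᵢ z)_B(x)`.  (b) Both sides are holomorphic on `{1 < Re} ∖ (Sp ∪ ⋃ Spᵢ)` (★ `differentiableOn_borelConstantTerm_slitPlane_cm_three`, from T's exports:
holomorphy, continuity, joint local bound), hence equal there (★ `eqOn_reSlit_of_eqOn_re_gt`).  (c) Subtracting the flat parts with `hdec` at `z`: `ψ_z(x g)·H(x g)^{2−z} =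
Σᵢ cᵢ^z ψᵢ_z(x)·H(x)^{2−z}`, i.e. `g·(M(z)φ) = M(z)(g·φ)` as functions on `G(𝔸)` — THE OPERATOR EQUIVARIANCE on the slit half-plane.  (d) The slit domain is a punctured neighbourhood
of `3∕2`; multiplying by `(z − 3∕2)` and passing to the limit along `𝓝[≠] 3∕2` (`cᵢ^z → cᵢ^{3/2}`, uniqueness of limits): `ρψ(x g)·H(x g)^{1/2} = Σᵢ cᵢ^{3/2} ρψᵢ(x)·H(x)^{1/2}`, i.e.
`g·(M₋₁φ) = M₋₁(g·φ)`.
* §1 `borelConstantTerm_apply_mul` (`(F)_B(x g) = (r(g)F)_B(x)`), `borelConstantTerm_finset_sum_mul` (finite linearity on integrable integrands).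
* §2 `eisenstein_translate_eq_sum_of_two_lt_re` (step (a), every `y`), **`borelConstantTerm_translate_eq_sum`** (steps (a)–(b): `(Ec z)_B(x g) = Σᵢ cᵢ^z (Ecᵢ z)_B(x)` on the slit
  half-plane), **`ctSecondCoeff_translate_eq_sum`** ∕ **`ctSecondCoeff_translate_eq_sum_of_letters`** (step (c), difference form ∕ ℓ-CT letter form),
  **`ctResidue_translate_eq_sum`** ∕ **`ctResidue_translate_eq_sum_of_letters`** (step (d), `M₋₁`).
HONEST LABEL: HC_CM is proved only modulo the 7 printed citations (2 remaining named inputs: hLiu418 = `stmt-HodgeConjecture-24832`, h413 = `stmt-HodgeConjecture-24833`) until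
rung 0 closes; REL ≠ ★ ≠ BUILT; visible inputs as BINDERS: the re-expansion `hdec` ((T_f) FILE A), the continuation data of `φ` and of the pieces (ESTATE T's exports), the ℓ-CT letters;
pays no socket; count-neutral.

## References
* [MoeglinWaldspurger1995] C. Mœglin, J.-L. Waldspurger, *Spectral Decomposition and Eisenstein Series* (1995), II.1.7, IV.1.9–IV.1.11.
* [Langlands1976] R. P. Langlands, *On the Functional Equations Satisfied by Eisenstein Series*, LNM 544 (1976), §7.
* [Conway1978] J. B. Conway, *Functions of One Complex Variable*, 2nd ed., GTM 11 (1978), IV §3.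
-/

set_option autoImplicit false
set_option linter.dupNamespace false  -- the mandated namespace `…HodgeConjecture.HodgeConjecture.R90.S8` (LEAD #1 L1) repeats the summit's segment

noncomputable section

open MeasureTheory Measure Set Filter Topology NumberField ContRepresentation
open Literature.NumberTheory Literature.NumberTheory.Automorphic Literature.NumberTheory.Automorphic.UnitaryGroup Literature.NumberTheory.GaloisRepresentations AdelicGroupData
open Literature.NumberTheory.Automorphic.Arthur2013.Leaves.TECR Literature.NumberTheory.Rogawski1990
open Summit.HodgeConjecture.HodgeConjecture.Cruxes.H413.K2E1BorelEisensteinU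
open Summit.HodgeConjecture.HodgeConjecture.Cruxes.H413.K2E1CharacterEisensteinU3PairDefs
open Summit.HodgeConjecture.HodgeConjecture.Cruxes.H413.K2E1ChiSectionSpaceU3PairDefs
open Summit.HodgeConjecture.HodgeConjecture.Cruxes.H413.K2E1ChiConstantTermHolomorphicCMThree (differentiableOn_borelConstantTerm_slitPlane_cm_three)
open scoped ENNReal NNReal

namespace Summit.HodgeConjecture.HodgeConjecture.R90.S8

/-! ## §1 The Borel constant term commutes with right translations and is finitely linear -/

section ConstantTerm

variable {F E : Type} [Field F] [NumberField F] [Field E] [NumberField E] [Algebra F E] {c : E ≃ₐ[F] E} {N : ℕ}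
variable [MeasurableSpace (quasiSplit F E c N).Adelic]

/-- **`(F)_B(x·g) = (r(g)F)_B(x)`**: the Borel constant term (an average over `u ∈ 𝓕 ⊂ N(𝔸)` of `F(u·y)`) commutes with right translations — `mul_assoc` under the integral; no
convergence is needed. [cite: MoeglinWaldspurger1995, II.1.7] -/
theorem borelConstantTerm_apply_mul (ν : Measure ↥(adelicUnipotent F E c N)) (𝓕 : Set ↥(adelicUnipotent F E c N)) (Φ : (quasiSplit F E c N).Adelic → ℂ) (x g : (quasiSplit F E c N).Adelic) :
    borelConstantTerm ν 𝓕 Φ (x * g) = borelConstantTerm ν 𝓕 (fun y => Φ (y * g)) x := by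
  simp only [borelConstantTerm_def, mul_assoc]

/-- **Finite linearity of the Borel constant term**: `(Σᵢ aᵢ Fᵢ)_B(x) = Σᵢ aᵢ (Fᵢ)_B(x)` as soon as every `u ↦ Fᵢ(u·x)` is integrable on `𝓕` (`integral_finsetSum`, `integral_const_mul`).
[cite: MoeglinWaldspurger1995, II.1.7] -/
theorem borelConstantTerm_finset_sum_mul (ν : Measure ↥(adelicUnipotent F E c N)) (𝓕 : Set ↥(adelicUnipotent F E c N)) {ι : Type*} (s : Finset ι) (a : ι → ℂ)
    (Φ : ι → (quasiSplit F E c N).Adelic → ℂ) (x : (quasiSplit F E c N).Adelic) (hint : ∀ i ∈ s, IntegrableOn (fun u : ↥(adelicUnipotent F E c N) => Φ i ((u : (quasiSplit F E c N).Adelic) * x)) 𝓕 ν) :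
    borelConstantTerm ν 𝓕 (fun y => ∑ i ∈ s, a i * Φ i y) x = ∑ i ∈ s, a i * borelConstantTerm ν 𝓕 (Φ i) x := by
  simp only [borelConstantTerm_def]
  rw [integral_finsetSum s fun i hi => (hint i hi).const_mul (a i), Finset.smul_sum]
  refine Finset.sum_congr rfl fun i _ => ?_
  rw [integral_const_mul, Complex.real_smul, Complex.real_smul]
  ring

end ConstantTerm

/-! ## §2 Operator equivariance of the second constant-term coefficient and of its residue along a finite flat re-expansion -/

section Main

variable (L : Type) [Field L] [NumberField L] [IsCMField L]
  [MeasurableSpace (quasiSplit (↥(maximalRealSubfield L)) L (IsCMField.complexConj L) 3).Adelic] [BorelSpace (quasiSplit (↥(maximalRealSubfield L)) L (IsCMField.complexConj L) 3).Adelic]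
  (ξ : OneDimAutRepH L) (μω : HeckeCharacter L)

omit [MeasurableSpace (quasiSplit (↥(maximalRealSubfield L)) L (IsCMField.complexConj L) 3).Adelic] [BorelSpace (quasiSplit (↥(maximalRealSubfield L)) L (IsCMField.complexConj L) 3).Adelic] in
/-- **Step (a) at EVERY argument: `Ec z (y·g) = Σᵢ cᵢ^z Ecᵢ z y` for `2 < Re z`** along a finite flat re-expansion `flat(φ,z)(y g) = Σᵢ cᵢ^z flat(ψᵢ,z)(y)` — ★
`eisensteinSeriesU_rightTranslation`, finite linearity ★ `eisensteinSeriesU_finset_sum` under Godement summability ★ `hSUM_of_unitary` (`μω` unitary). [cite: MoeglinWaldspurger1995, II.1.5, II.1.7] -/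
theorem eisenstein_translate_eq_sum_of_two_lt_re (hμu : μω.IsUnitary)
    {φ : (quasiSplit (↥(maximalRealSubfield L)) L (IsCMField.complexConj L) 3).Adelic → ℂ} (Ec : ℂ → (quasiSplit (↥(maximalRealSubfield L)) L (IsCMField.complexConj L) 3).Adelic → ℂ)
      (hEc : ∀ z : ℂ, 2 < z.re → Ec z = eisensteinSeriesU (flatSectionU φ z))
    (g : (quasiSplit (↥(maximalRealSubfield L)) L (IsCMField.complexConj L) 3).Adelic) {ι : Type*} (s : Finset ι) (c : ι → ℝ≥0)
    (ψ : ι → (quasiSplit (↥(maximalRealSubfield L)) L (IsCMField.complexConj L) 3).Adelic → ℂ)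
    (hψ : ∀ i ∈ s, ψ i ∈ chiSectionSpacePair (ξ.bcη⁻¹ * ξ.bcψ⁻¹ * μω) ξ.ψ (⊥ : Subgroup (quasiSplit (↥(maximalRealSubfield L)) L (IsCMField.complexConj L) 3).Adelic) ((1 : ↥(⊥ : Subgroup (quasiSplit (↥(maximalRealSubfield L)) L (IsCMField.complexConj L) 3).Adelic) →* ℂ) : ↥(⊥ : Subgroup (quasiSplit (↥(maximalRealSubfield L)) L (IsCMField.complexConj L) 3).Adelic) → ℂ))
    (hψc : ∀ i ∈ s, Continuous (ψ i))
    (Ecι : ι → ℂ → (quasiSplit (↥(maximalRealSubfield L)) L (IsCMField.complexConj L) 3).Adelic → ℂ) (hEcι : ∀ i ∈ s, ∀ z : ℂ, 2 < z.re → Ecι i z = eisensteinSeriesU (flatSectionU (ψ i) z))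
    (hdec : ∀ (z : ℂ) (x : (quasiSplit (↥(maximalRealSubfield L)) L (IsCMField.complexConj L) 3).Adelic), flatSectionU φ z (x * g) = ∑ i ∈ s, (((c i : ℝ) : ℂ) ^ z) * flatSectionU (ψ i) z x)
    (z : ℂ) (hz : 2 < z.re) (y : (quasiSplit (↥(maximalRealSubfield L)) L (IsCMField.complexConj L) 3).Adelic) :
    Ec z (y * g) = ∑ i ∈ s, (((c i : ℝ) : ℂ) ^ z) * Ecι i z y := by
  classical
  have hsumψ : ∀ i ∈ s, Summable fun q : Quotient (MulAction.orbitRel ↥(borelU ((IsCMField.complexConj L : L ≃ₐ[↥(maximalRealSubfield L)] L) : L →+* L) ((StdForm.antidiagonal 3).over L)) ↥(unitaryGroupOfForm ((IsCMField.complexConj L : L ≃ₐ[↥(maximalRealSubfield L)] L) : L →+* L) ((StdForm.antidiagonal 3).over L))) => flatSectionU (ψ i) z ((quasiSplit (↥(maximalRealSubfield L)) L (IsCMField.complexConj L) 3).toAdelic (Quotient.out q : ↥(unitaryGroupOfForm ((IsCMField.complexConj L : L ≃ₐ[↥(maximalRealSubfield L)] L) : L →+* L) ((StdForm.antidiagonal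 3).over L))) * y) := fun i hi =>
    (hSUM_of_unitary L ξ μω hμu (norm_eta_apply_eq_one L ξ) (norm_psi_apply_eq_one L ξ) (ψ i) (hψ i hi) (hψc i hi) z hz y).of_norm
  have hre : rightTranslation (quasiSplit (↥(maximalRealSubfield L)) L (IsCMField.complexConj L) 3) g (flatSectionU φ z) = ∑ i ∈ s, (((c i : ℝ) : ℂ) ^ z) • flatSectionU (ψ i) z := by
    funext y'
    rw [rightTranslation_apply, hdec z y', Finset.sum_apply]
    simp only [Pi.smul_apply, smul_eq_mul]
  rw [hEc z hz, ← eisensteinSeriesU_rightTranslation L (flatSectionU φ z) g y, hre, eisensteinSeriesU_finset_sum L s _ _ y (fun i hi => hsumψ i hi)]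
  exact Finset.sum_congr rfl fun i hi => by rw [hEcι i hi z hz]

/-- **`(Ec z)_B(x·g) = Σᵢ cᵢ^z (Ecᵢ z)_B(x)` ON THE SLIT HALF-PLANE `{1 < Re} ∖ (Sp ∪ ⋃ᵢ Spᵢ)`** — steps (a)–(b) of the module docstring: on `{2 < Re}` by the previous theorem under the
`N(𝔸)`-average (§1; the integrands are continuous — T's export `hE4` — on the relatively compact `𝓕`), then by the identity theorem ★ `eqOn_reSlit_of_eqOn_re_gt`, both sides being holomorphic
there (★ `differentiableOn_borelConstantTerm_slitPlane_cm_three` from T's exports `hEd`∕`hE4`∕`hEbd` of `φ` and of every piece). [cite: MoeglinWaldspurger1995, II.1.7, IV.1.9–IV.1.11] [cite: Conway1978, IV §3] -/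
theorem borelConstantTerm_translate_eq_sum (hμu : μω.IsUnitary)
    {φ : (quasiSplit (↥(maximalRealSubfield L)) L (IsCMField.complexConj L) 3).Adelic → ℂ} (Ec : ℂ → (quasiSplit (↥(maximalRealSubfield L)) L (IsCMField.complexConj L) 3).Adelic → ℂ) (Sp : Finset ℂ) (hSp : ∀ s ∈ Sp, s.im = 0 ∧ 1 < s.re ∧ s.re ≤ 2)
      (hol : ∀ g, DifferentiableOn ℂ (fun z => Ec z g) ({z : ℂ | 1 < z.re} \ (↑Sp : Set ℂ)))
      (hE4 : ∀ z ∈ ({z : ℂ | 1 < z.re} \ (↑Sp : Set ℂ)), Continuous (Ec z))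
      (hEbd : ∀ z₁ ∈ ({z : ℂ | 1 < z.re} \ (↑Sp : Set ℂ)), ∀ K : Set (quasiSplit (↥(maximalRealSubfield L)) L (IsCMField.complexConj L) 3).Adelic, IsCompact K → ∃ V ∈ 𝓝 z₁, ∃ M : ℝ, ∀ z ∈ V, ∀ g ∈ K, ‖Ec z g‖ ≤ M)
      (hEc : ∀ z : ℂ, 2 < z.re → Ec z = eisensteinSeriesU (flatSectionU φ z))
    (ν : Measure ↥(adelicUnipotent (↥(maximalRealSubfield L)) L (IsCMField.complexConj L) 3)) [ν.IsHaarMeasure] {𝓕 : Set ↥(adelicUnipotent (↥(maximalRealSubfield L)) L (IsCMField.complexConj L) 3)}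
      (h𝓕N : IsFundamentalDomain ↥(rationalUnipotent (↥(maximalRealSubfield L)) L (IsCMField.complexConj L) 3) 𝓕 ν) (h𝓕c : IsCompact (closure 𝓕))
    (g : (quasiSplit (↥(maximalRealSubfield L)) L (IsCMField.complexConj L) 3).Adelic) {ι : Type*} (s : Finset ι) (c : ι → ℝ≥0) (hc : ∀ i ∈ s, 0 < c i)
    (ψ : ι → (quasiSplit (↥(maximalRealSubfield L)) L (IsCMField.complexConj L) 3).Adelic → ℂ)
    (hψ : ∀ i ∈ s, ψ i ∈ chiSectionSpacePair (ξ.bcη⁻¹ * ξ.bcψ⁻¹ * μω) ξ.ψ (⊥ : Subgroup (quasiSplit (↥(maximalRealSubfield L)) L (IsCMField.complexConj L) 3).Adelic) ((1 : ↥(⊥ : Subgroup (quasiSplit (↥(maximalRealSubfield L)) L (IsCMField.complexConj L) 3).Adelic) →* ℂ) : ↥(⊥ : Subgroup (quasiSplit (↥(maximalRealSubfield L)) L (IsCMField.complexConj L) 3).Adelic) → ℂ))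
    (hψc : ∀ i ∈ s, Continuous (ψ i))
    (Ecι : ι → ℂ → (quasiSplit (↥(maximalRealSubfield L)) L (IsCMField.complexConj L) 3).Adelic → ℂ) (Spι : ι → Finset ℂ) (hSpι : ∀ i ∈ s, ∀ t ∈ Spι i, t.im = 0 ∧ 1 < t.re ∧ t.re ≤ 2)
    (holι : ∀ i ∈ s, ∀ y, DifferentiableOn ℂ (fun z => Ecι i z y) ({z : ℂ | 1 < z.re} \ (↑(Spι i) : Set ℂ)))
    (hE4ι : ∀ i ∈ s, ∀ z ∈ ({z : ℂ | 1 < z.re} \ (↑(Spι i) : Set ℂ)), Continuous (Ecι i z))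
    (hEbdι : ∀ i ∈ s, ∀ z₁ ∈ ({z : ℂ | 1 < z.re} \ (↑(Spι i) : Set ℂ)), ∀ K : Set (quasiSplit (↥(maximalRealSubfield L)) L (IsCMField.complexConj L) 3).Adelic, IsCompact K → ∃ V ∈ 𝓝 z₁, ∃ M : ℝ, ∀ z ∈ V, ∀ y ∈ K, ‖Ecι i z y‖ ≤ M)
    (hEcι : ∀ i ∈ s, ∀ z : ℂ, 2 < z.re → Ecι i z = eisensteinSeriesU (flatSectionU (ψ i) z))
    (hdec : ∀ (z : ℂ) (x : (quasiSplit (↥(maximalRealSubfield L)) L (IsCMField.complexConj L) 3).Adelic), flatSectionU φ z (x * g) = ∑ i ∈ s, (((c i : ℝ) : ℂ) ^ z) * flatSectionU (ψ i) z x)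
    (x : (quasiSplit (↥(maximalRealSubfield L)) L (IsCMField.complexConj L) 3).Adelic) :
    ∀ z ∈ ({z : ℂ | 1 < z.re} \ (↑(Sp ∪ s.biUnion Spι) : Set ℂ)),
      borelConstantTerm ν 𝓕 (Ec z) (x * g) = ∑ i ∈ s, (((c i : ℝ) : ℂ) ^ z) * borelConstantTerm ν 𝓕 (Ecι i z) x := by
  classical
  -- (a) on the Godement half-plane, under the `N(𝔸)`-average
  have hgod : ∀ z : ℂ, 2 < z.re → borelConstantTerm ν 𝓕 (Ec z) (x * g) = ∑ i ∈ s, (((c i : ℝ) : ℂ) ^ z) * borelConstantTerm ν 𝓕 (Ecι i z) x := by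
    intro z hz
    have hfun : (fun y => Ec z (y * g)) = fun y => ∑ i ∈ s, (((c i : ℝ) : ℂ) ^ z) * Ecι i z y :=
      funext fun y => eisenstein_translate_eq_sum_of_two_lt_re L ξ μω hμu Ec hEc g s c ψ hψ hψc Ecι hEcι hdec z hz y
    rw [borelConstantTerm_apply_mul, hfun]
    refine borelConstantTerm_finset_sum_mul ν 𝓕 s _ _ x fun i hi => ?_
    -- the piece `Ecᵢ z` is continuous at `2 < Re z` (off its real slit of abscissae `≤ 2`), so `u ↦ Ecᵢ z (u x)` is integrable on the relatively compact `𝓕`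
    have hzi : z ∈ ({z : ℂ | 1 < z.re} \ (↑(Spι i) : Set ℂ)) :=
      ⟨lt_trans (by norm_num) hz, fun hzS => (lt_irrefl (2 : ℝ)) (lt_of_lt_of_le hz ((hSpι i hi z (Finset.mem_coe.1 hzS)).2.2))⟩
    have hcont : Continuous fun u : ↥(adelicUnipotent (↥(maximalRealSubfield L)) L (IsCMField.complexConj L) 3) => Ecι i z ((u : (quasiSplit (↥(maximalRealSubfield L)) L (IsCMField.complexConj L) 3).Adelic) * x) :=
      (hE4ι i hi z hzi).comp (continuous_subtype_val.mul continuous_const)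
    exact (hcont.continuousOn.integrableOn_compact' h𝓕c isClosed_closure.measurableSet).mono_set subset_closure
  -- (b) identity theorem on the slit half-plane off the union of the real slits
  set S : Set ℂ := (↑(Sp ∪ s.biUnion Spι) : Set ℂ) with hSdef
  have hSreal : ∀ t ∈ S, t.im = 0 := by
    intro t ht
    rcases Finset.mem_union.1 (Finset.mem_coe.1 ht) with h | h
    · exact (hSp t h).1
    · obtain ⟨i, hi, hti⟩ := Finset.mem_biUnion.1 h
      exact (hSpι i hi t hti).1
  have hSclosed : IsClosed S := (Sp ∪ s.biUnion Spι).finite_toSet.isClosed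
  have hsubL : ({z : ℂ | 1 < z.re} \ S) ⊆ {z : ℂ | 1 < z.re} \ (↑Sp : Set ℂ) :=
    Set.sdiff_subset_sdiff_right (Finset.coe_subset.2 Finset.subset_union_left)
  have hsubR : ∀ i ∈ s, ({z : ℂ | 1 < z.re} \ S) ⊆ {z : ℂ | 1 < z.re} \ (↑(Spι i) : Set ℂ) := fun i hi =>
    Set.sdiff_subset_sdiff_right (Finset.coe_subset.2 ((Finset.subset_biUnion_of_mem Spι hi).trans Finset.subset_union_right))
  have holL : DifferentiableOn ℂ (fun z => borelConstantTerm ν 𝓕 (Ec z) (x * g)) ({z : ℂ | 1 < z.re} \ S) :=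
    (differentiableOn_borelConstantTerm_slitPlane_cm_three L Ec Sp hol hE4 hEbd ν h𝓕N h𝓕c (x * g)).mono hsubL
  have holR : DifferentiableOn ℂ (fun z => ∑ i ∈ s, (((c i : ℝ) : ℂ) ^ z) * borelConstantTerm ν 𝓕 (Ecι i z) x) ({z : ℂ | 1 < z.re} \ S) := by
    refine DifferentiableOn.fun_sum fun i hi => ?_
    have hci : ((c i : ℝ) : ℂ) ≠ 0 := by exact_mod_cast (hc i hi).ne'
    have hd : Differentiable ℂ (fun z : ℂ => ((c i : ℝ) : ℂ) ^ z) := fun z => differentiableAt_id.const_cpow (Or.inl hci)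
    exact hd.differentiableOn.mul ((differentiableOn_borelConstantTerm_slitPlane_cm_three L (Ecι i) (Spι i) (holι i hi) (hE4ι i hi) (hEbdι i hi) ν h𝓕N h𝓕c x).mono (hsubR i hi))
  exact eqOn_reSlit_of_eqOn_re_gt hSreal hSclosed holL holR hgod

/-- **`M(z)(g·φ) = g·(M(z)φ)` — THE OPERATOR EQUIVARIANCE OF THE SECOND CONSTANT-TERM COEFFICIENT, difference form**: on the slit half-plane `{1 < Re} ∖ (Sp ∪ ⋃ᵢ Spᵢ)`,
`(Ec z)_B(x g) − flat(φ,z)(x g) = Σᵢ cᵢ^z·((Ecᵢ z)_B(x) − flat(ψᵢ,z)(x))` — the previous theorem minus the re-expansion `hdec` at `z`. [cite: MoeglinWaldspurger1995, II.1.7, IV.1.9–IV.1.11] -/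
theorem ctSecondCoeff_translate_eq_sum (hμu : μω.IsUnitary)
    {φ : (quasiSplit (↥(maximalRealSubfield L)) L (IsCMField.complexConj L) 3).Adelic → ℂ} (Ec : ℂ → (quasiSplit (↥(maximalRealSubfield L)) L (IsCMField.complexConj L) 3).Adelic → ℂ) (Sp : Finset ℂ) (hSp : ∀ s ∈ Sp, s.im = 0 ∧ 1 < s.re ∧ s.re ≤ 2)
      (hol : ∀ g, DifferentiableOn ℂ (fun z => Ec z g) ({z : ℂ | 1 < z.re} \ (↑Sp : Set ℂ)))
      (hE4 : ∀ z ∈ ({z : ℂ | 1 < z.re} \ (↑Sp : Set ℂ)), Continuous (Ec z))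
      (hEbd : ∀ z₁ ∈ ({z : ℂ | 1 < z.re} \ (↑Sp : Set ℂ)), ∀ K : Set (quasiSplit (↥(maximalRealSubfield L)) L (IsCMField.complexConj L) 3).Adelic, IsCompact K → ∃ V ∈ 𝓝 z₁, ∃ M : ℝ, ∀ z ∈ V, ∀ g ∈ K, ‖Ec z g‖ ≤ M)
      (hEc : ∀ z : ℂ, 2 < z.re → Ec z = eisensteinSeriesU (flatSectionU φ z))
    (ν : Measure ↥(adelicUnipotent (↥(maximalRealSubfield L)) L (IsCMField.complexConj L) 3)) [ν.IsHaarMeasure] {𝓕 : Set ↥(adelicUnipotent (↥(maximalRealSubfield L)) L (IsCMField.complexConj L) 3)}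
      (h𝓕N : IsFundamentalDomain ↥(rationalUnipotent (↥(maximalRealSubfield L)) L (IsCMField.complexConj L) 3) 𝓕 ν) (h𝓕c : IsCompact (closure 𝓕))
    (g : (quasiSplit (↥(maximalRealSubfield L)) L (IsCMField.complexConj L) 3).Adelic) {ι : Type*} (s : Finset ι) (c : ι → ℝ≥0) (hc : ∀ i ∈ s, 0 < c i)
    (ψ : ι → (quasiSplit (↥(maximalRealSubfield L)) L (IsCMField.complexConj L) 3).Adelic → ℂ)
    (hψ : ∀ i ∈ s, ψ i ∈ chiSectionSpacePair (ξ.bcη⁻¹ * ξ.bcψ⁻¹ * μω) ξ.ψ (⊥ : Subgroup (quasiSplit (↥(maximalRealSubfield L)) L (IsCMField.complexConj L) 3).Adelic) ((1 : ↥(⊥ : Subgroup (quasiSplit (↥(maximalRealSubfield L)) L (IsCMField.complexConj L) 3).Adelic) →* ℂ) : ↥(⊥ : Subgroup (quasiSplit (↥(maximalRealSubfield L)) L (IsCMField.complexConj L) 3).Adelic) → ℂ))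
    (hψc : ∀ i ∈ s, Continuous (ψ i))
    (Ecι : ι → ℂ → (quasiSplit (↥(maximalRealSubfield L)) L (IsCMField.complexConj L) 3).Adelic → ℂ) (Spι : ι → Finset ℂ) (hSpι : ∀ i ∈ s, ∀ t ∈ Spι i, t.im = 0 ∧ 1 < t.re ∧ t.re ≤ 2)
    (holι : ∀ i ∈ s, ∀ y, DifferentiableOn ℂ (fun z => Ecι i z y) ({z : ℂ | 1 < z.re} \ (↑(Spι i) : Set ℂ)))
    (hE4ι : ∀ i ∈ s, ∀ z ∈ ({z : ℂ | 1 < z.re} \ (↑(Spι i) : Set ℂ)), Continuous (Ecι i z))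
    (hEbdι : ∀ i ∈ s, ∀ z₁ ∈ ({z : ℂ | 1 < z.re} \ (↑(Spι i) : Set ℂ)), ∀ K : Set (quasiSplit (↥(maximalRealSubfield L)) L (IsCMField.complexConj L) 3).Adelic, IsCompact K → ∃ V ∈ 𝓝 z₁, ∃ M : ℝ, ∀ z ∈ V, ∀ y ∈ K, ‖Ecι i z y‖ ≤ M)
    (hEcι : ∀ i ∈ s, ∀ z : ℂ, 2 < z.re → Ecι i z = eisensteinSeriesU (flatSectionU (ψ i) z))
    (hdec : ∀ (z : ℂ) (x : (quasiSplit (↥(maximalRealSubfield L)) L (IsCMField.complexConj L) 3).Adelic), flatSectionU φ z (x * g) = ∑ i ∈ s, (((c i : ℝ) : ℂ) ^ z) * flatSectionU (ψ i) z x)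
    (x : (quasiSplit (↥(maximalRealSubfield L)) L (IsCMField.complexConj L) 3).Adelic) :
    ∀ z ∈ ({z : ℂ | 1 < z.re} \ (↑(Sp ∪ s.biUnion Spι) : Set ℂ)),
      borelConstantTerm ν 𝓕 (Ec z) (x * g) - flatSectionU φ z (x * g) = ∑ i ∈ s, (((c i : ℝ) : ℂ) ^ z) * (borelConstantTerm ν 𝓕 (Ecι i z) x - flatSectionU (ψ i) z x) := by
  intro z hz
  rw [borelConstantTerm_translate_eq_sum L ξ μω hμu Ec Sp hSp hol hE4 hEbd hEc ν h𝓕N h𝓕c g s c hc ψ hψ hψc Ecι Spι hSpι holι hE4ι hEbdι hEcι hdec x z hz, hdec z x, ← Finset.sum_sub_distrib]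
  exact Finset.sum_congr rfl fun i _ => by ring

/-- **`M(z)(g·φ) = g·(M(z)φ)` IN THE ℓ-CT LETTERS**: if `(Ec z)_B = φ·H^z + ψ_z·H^{2−z}` on `{1 < Re} ∖ Sp` (★ `ctPackage_of_scalarRoad`'s SHAPE, by-value letter `ψz`) and likewise
`(Ecᵢ z)_B = ψᵢ·H^z + ψᵢ_z·H^{2−z}` (letters `ψzι i`), then on the slit half-plane `ψ_z(x g)·H(x g)^{2−z} = Σᵢ cᵢ^z·ψᵢ_z(x)·H(x)^{2−z}`: the translate `g·(M(z)φ)` of the intertwined flat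
section is the intertwined image `M(z)(g·φ) = Σᵢ cᵢ^z M(z)ψᵢ` of the re-expanded one. [cite: MoeglinWaldspurger1995, II.1.7, IV.1.9–IV.1.11] [cite: Langlands1976, §7] -/
theorem ctSecondCoeff_translate_eq_sum_of_letters (hμu : μω.IsUnitary)
    {φ : (quasiSplit (↥(maximalRealSubfield L)) L (IsCMField.complexConj L) 3).Adelic → ℂ} (Ec : ℂ → (quasiSplit (↥(maximalRealSubfield L)) L (IsCMField.complexConj L) 3).Adelic → ℂ) (Sp : Finset ℂ) (hSp : ∀ s ∈ Sp, s.im = 0 ∧ 1 < s.re ∧ s.re ≤ 2)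
      (hol : ∀ g, DifferentiableOn ℂ (fun z => Ec z g) ({z : ℂ | 1 < z.re} \ (↑Sp : Set ℂ)))
      (hE4 : ∀ z ∈ ({z : ℂ | 1 < z.re} \ (↑Sp : Set ℂ)), Continuous (Ec z))
      (hEbd : ∀ z₁ ∈ ({z : ℂ | 1 < z.re} \ (↑Sp : Set ℂ)), ∀ K : Set (quasiSplit (↥(maximalRealSubfield L)) L (IsCMField.complexConj L) 3).Adelic, IsCompact K → ∃ V ∈ 𝓝 z₁, ∃ M : ℝ, ∀ z ∈ V, ∀ g ∈ K, ‖Ec z g‖ ≤ M)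
      (hEc : ∀ z : ℂ, 2 < z.re → Ec z = eisensteinSeriesU (flatSectionU φ z))
    (ν : Measure ↥(adelicUnipotent (↥(maximalRealSubfield L)) L (IsCMField.complexConj L) 3)) [ν.IsHaarMeasure] {𝓕 : Set ↥(adelicUnipotent (↥(maximalRealSubfield L)) L (IsCMField.complexConj L) 3)}
      (h𝓕N : IsFundamentalDomain ↥(rationalUnipotent (↥(maximalRealSubfield L)) L (IsCMField.complexConj L) 3) 𝓕 ν) (h𝓕c : IsCompact (closure 𝓕))
      (ψz : ℂ → (quasiSplit (↥(maximalRealSubfield L)) L (IsCMField.complexConj L) 3).Adelic → ℂ)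
      (hct : ∀ z ∈ ({z : ℂ | 1 < z.re} \ (↑Sp : Set ℂ)), ∀ y : (quasiSplit (↥(maximalRealSubfield L)) L (IsCMField.complexConj L) 3).Adelic,
        borelConstantTerm ν 𝓕 (Ec z) y = φ y * (((borelHeight y : ℝ≥0) : ℝ) : ℂ) ^ z + ψz z y * (((borelHeight y : ℝ≥0) : ℝ) : ℂ) ^ (2 - z))
    (g : (quasiSplit (↥(maximalRealSubfield L)) L (IsCMField.complexConj L) 3).Adelic) {ι : Type*} (s : Finset ι) (c : ι → ℝ≥0) (hc : ∀ i ∈ s, 0 < c i)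
    (ψ : ι → (quasiSplit (↥(maximalRealSubfield L)) L (IsCMField.complexConj L) 3).Adelic → ℂ)
    (hψ : ∀ i ∈ s, ψ i ∈ chiSectionSpacePair (ξ.bcη⁻¹ * ξ.bcψ⁻¹ * μω) ξ.ψ (⊥ : Subgroup (quasiSplit (↥(maximalRealSubfield L)) L (IsCMField.complexConj L) 3).Adelic) ((1 : ↥(⊥ : Subgroup (quasiSplit (↥(maximalRealSubfield L)) L (IsCMField.complexConj L) 3).Adelic) →* ℂ) : ↥(⊥ : Subgroup (quasiSplit (↥(maximalRealSubfield L)) L (IsCMField.complexConj L) 3).Adelic) → ℂ))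
    (hψc : ∀ i ∈ s, Continuous (ψ i))
    (Ecι : ι → ℂ → (quasiSplit (↥(maximalRealSubfield L)) L (IsCMField.complexConj L) 3).Adelic → ℂ) (Spι : ι → Finset ℂ) (hSpι : ∀ i ∈ s, ∀ t ∈ Spι i, t.im = 0 ∧ 1 < t.re ∧ t.re ≤ 2)
    (holι : ∀ i ∈ s, ∀ y, DifferentiableOn ℂ (fun z => Ecι i z y) ({z : ℂ | 1 < z.re} \ (↑(Spι i) : Set ℂ)))
    (hE4ι : ∀ i ∈ s, ∀ z ∈ ({z : ℂ | 1 < z.re} \ (↑(Spι i) : Set ℂ)), Continuous (Ecι i z))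
    (hEbdι : ∀ i ∈ s, ∀ z₁ ∈ ({z : ℂ | 1 < z.re} \ (↑(Spι i) : Set ℂ)), ∀ K : Set (quasiSplit (↥(maximalRealSubfield L)) L (IsCMField.complexConj L) 3).Adelic, IsCompact K → ∃ V ∈ 𝓝 z₁, ∃ M : ℝ, ∀ z ∈ V, ∀ y ∈ K, ‖Ecι i z y‖ ≤ M)
    (hEcι : ∀ i ∈ s, ∀ z : ℂ, 2 < z.re → Ecι i z = eisensteinSeriesU (flatSectionU (ψ i) z))
      (ψzι : ι → ℂ → (quasiSplit (↥(maximalRealSubfield L)) L (IsCMField.complexConj L) 3).Adelic → ℂ)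
      (hctι : ∀ i ∈ s, ∀ z ∈ ({z : ℂ | 1 < z.re} \ (↑(Spι i) : Set ℂ)), ∀ y : (quasiSplit (↥(maximalRealSubfield L)) L (IsCMField.complexConj L) 3).Adelic,
        borelConstantTerm ν 𝓕 (Ecι i z) y = ψ i y * (((borelHeight y : ℝ≥0) : ℝ) : ℂ) ^ z + ψzι i z y * (((borelHeight y : ℝ≥0) : ℝ) : ℂ) ^ (2 - z))
    (hdec : ∀ (z : ℂ) (x : (quasiSplit (↥(maximalRealSubfield L)) L (IsCMField.complexConj L) 3).Adelic), flatSectionU φ z (x * g) = ∑ i ∈ s, (((c i : ℝ) : ℂ) ^ z) * flatSectionU (ψ i) z x)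
    (x : (quasiSplit (↥(maximalRealSubfield L)) L (IsCMField.complexConj L) 3).Adelic) :
    ∀ z ∈ ({z : ℂ | 1 < z.re} \ (↑(Sp ∪ s.biUnion Spι) : Set ℂ)),
      ψz z (x * g) * (((borelHeight (x * g) : ℝ≥0) : ℝ) : ℂ) ^ (2 - z) = ∑ i ∈ s, (((c i : ℝ) : ℂ) ^ z) * (ψzι i z x * (((borelHeight x : ℝ≥0) : ℝ) : ℂ) ^ (2 - z)) := by
  classical
  intro z hz
  have hzL : z ∈ ({z : ℂ | 1 < z.re} \ (↑Sp : Set ℂ)) := ⟨hz.1, fun h => hz.2 (Finset.mem_coe.2 (Finset.mem_union_left _ (Finset.mem_coe.1 h)))⟩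
  have hzR : ∀ i ∈ s, z ∈ ({z : ℂ | 1 < z.re} \ (↑(Spι i) : Set ℂ)) := fun i hi =>
    ⟨hz.1, fun h => hz.2 (Finset.mem_coe.2 (Finset.mem_union_right _ (Finset.mem_biUnion.2 ⟨i, hi, Finset.mem_coe.1 h⟩)))⟩
  have h := ctSecondCoeff_translate_eq_sum L ξ μω hμu Ec Sp hSp hol hE4 hEbd hEc ν h𝓕N h𝓕c g s c hc ψ hψ hψc Ecι Spι hSpι holι hE4ι hEbdι hEcι hdec x z hz
  rw [hct z hzL (x * g), flatSectionU_apply, add_sub_cancel_left] at h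
  rw [h]
  exact Finset.sum_congr rfl fun i hi => by rw [hctι i hi z (hzR i hi) x, flatSectionU_apply, add_sub_cancel_left]

omit [MeasurableSpace (quasiSplit (↥(maximalRealSubfield L)) L (IsCMField.complexConj L) 3).Adelic] [BorelSpace (quasiSplit (↥(maximalRealSubfield L)) L (IsCMField.complexConj L) 3).Adelic] in
/-- **The slit half-plane is a punctured neighbourhood of `3∕2`**: for a finite set `S` of real abscissae, `{1 < Re} ∖ S` belongs to `𝓝[≠] (3∕2)` (remove `3∕2` from `S`: the rest is closed
and misses `3∕2`). [cite: Conway1978, IV §3] -/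
theorem reSlit_mem_nhdsNE_three_halves (S : Finset ℂ) : ({z : ℂ | 1 < z.re} \ (↑S : Set ℂ)) ∈ 𝓝[≠] ((3 : ℂ) / 2) := by
  have hO : IsOpen ({z : ℂ | 1 < z.re} \ ((↑S : Set ℂ) \ {(3 : ℂ) / 2})) :=
    (isOpen_lt continuous_const Complex.continuous_re).sdiff (S.finite_toSet.subset Set.sdiff_subset).isClosed
  have hmem : ((3 : ℂ) / 2) ∈ ({z : ℂ | 1 < z.re} \ ((↑S : Set ℂ) \ {(3 : ℂ) / 2})) :=
    ⟨by norm_num, fun h => h.2 rfl⟩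
  filter_upwards [mem_nhdsWithin_of_mem_nhds (hO.mem_nhds hmem), self_mem_nhdsWithin] with z hz hne
  exact ⟨hz.1, fun hzS => hz.2 ⟨hzS, hne⟩⟩

/-- **`M₋₁(g·φ) = g·(M₋₁φ)` — THE RESIDUE OF THE OPERATOR EQUIVARIANCE, difference form**: if `(z − 3∕2)·((Ec z)_B(y) − flat(φ,z)(y)) → R(y)` and `(z − 3∕2)·((Ecᵢ z)_B(y) − flat(ψᵢ,z)(y))
→ Rᵢ(y)` along `𝓝[≠] 3∕2`, then `R(x g) = Σᵢ cᵢ^{3/2} Rᵢ(x)`: the slit half-plane is a punctured neighbourhood of `3∕2` (`reSlit_mem_nhdsNE_three_halves`), the difference-form identity holds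
there, `cᵢ^z → cᵢ^{3/2}`, and limits along `𝓝[≠] 3∕2` are unique. [cite: MoeglinWaldspurger1995, IV.1.9–IV.1.11] [cite: Conway1978, IV §3] -/
theorem ctResidue_translate_eq_sum (hμu : μω.IsUnitary)
    {φ : (quasiSplit (↥(maximalRealSubfield L)) L (IsCMField.complexConj L) 3).Adelic → ℂ} (Ec : ℂ → (quasiSplit (↥(maximalRealSubfield L)) L (IsCMField.complexConj L) 3).Adelic → ℂ) (Sp : Finset ℂ) (hSp : ∀ s ∈ Sp, s.im = 0 ∧ 1 < s.re ∧ s.re ≤ 2)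
      (hol : ∀ g, DifferentiableOn ℂ (fun z => Ec z g) ({z : ℂ | 1 < z.re} \ (↑Sp : Set ℂ)))
      (hE4 : ∀ z ∈ ({z : ℂ | 1 < z.re} \ (↑Sp : Set ℂ)), Continuous (Ec z))
      (hEbd : ∀ z₁ ∈ ({z : ℂ | 1 < z.re} \ (↑Sp : Set ℂ)), ∀ K : Set (quasiSplit (↥(maximalRealSubfield L)) L (IsCMField.complexConj L) 3).Adelic, IsCompact K → ∃ V ∈ 𝓝 z₁, ∃ M : ℝ, ∀ z ∈ V, ∀ g ∈ K, ‖Ec z g‖ ≤ M)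
      (hEc : ∀ z : ℂ, 2 < z.re → Ec z = eisensteinSeriesU (flatSectionU φ z))
    (ν : Measure ↥(adelicUnipotent (↥(maximalRealSubfield L)) L (IsCMField.complexConj L) 3)) [ν.IsHaarMeasure] {𝓕 : Set ↥(adelicUnipotent (↥(maximalRealSubfield L)) L (IsCMField.complexConj L) 3)}
      (h𝓕N : IsFundamentalDomain ↥(rationalUnipotent (↥(maximalRealSubfield L)) L (IsCMField.complexConj L) 3) 𝓕 ν) (h𝓕c : IsCompact (closure 𝓕))
      (R : (quasiSplit (↥(maximalRealSubfield L)) L (IsCMField.complexConj L) 3).Adelic → ℂ)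
      (hR : ∀ y, Tendsto (fun z : ℂ => (z - (3 : ℂ) / 2) * (borelConstantTerm ν 𝓕 (Ec z) y - flatSectionU φ z y)) (𝓝[≠] ((3 : ℂ) / 2)) (𝓝 (R y)))
    (g : (quasiSplit (↥(maximalRealSubfield L)) L (IsCMField.complexConj L) 3).Adelic) {ι : Type*} (s : Finset ι) (c : ι → ℝ≥0) (hc : ∀ i ∈ s, 0 < c i)
    (ψ : ι → (quasiSplit (↥(maximalRealSubfield L)) L (IsCMField.complexConj L) 3).Adelic → ℂ)
    (hψ : ∀ i ∈ s, ψ i ∈ chiSectionSpacePair (ξ.bcη⁻¹ * ξ.bcψ⁻¹ * μω) ξ.ψ (⊥ : Subgroup (quasiSplit (↥(maximalRealSubfield L)) L (IsCMField.complexConj L) 3).Adelic) ((1 : ↥(⊥ : Subgroup (quasiSplit (↥(maximalRealSubfield L)) L (IsCMField.complexConj L) 3).Adelic) →* ℂ) : ↥(⊥ : Subgroup (quasiSplit (↥(maximalRealSubfield L)) L (IsCMField.complexConj L) 3).Adelic) → ℂ))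
    (hψc : ∀ i ∈ s, Continuous (ψ i))
    (Ecι : ι → ℂ → (quasiSplit (↥(maximalRealSubfield L)) L (IsCMField.complexConj L) 3).Adelic → ℂ) (Spι : ι → Finset ℂ) (hSpι : ∀ i ∈ s, ∀ t ∈ Spι i, t.im = 0 ∧ 1 < t.re ∧ t.re ≤ 2)
    (holι : ∀ i ∈ s, ∀ y, DifferentiableOn ℂ (fun z => Ecι i z y) ({z : ℂ | 1 < z.re} \ (↑(Spι i) : Set ℂ)))
    (hE4ι : ∀ i ∈ s, ∀ z ∈ ({z : ℂ | 1 < z.re} \ (↑(Spι i) : Set ℂ)), Continuous (Ecι i z))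
    (hEbdι : ∀ i ∈ s, ∀ z₁ ∈ ({z : ℂ | 1 < z.re} \ (↑(Spι i) : Set ℂ)), ∀ K : Set (quasiSplit (↥(maximalRealSubfield L)) L (IsCMField.complexConj L) 3).Adelic, IsCompact K → ∃ V ∈ 𝓝 z₁, ∃ M : ℝ, ∀ z ∈ V, ∀ y ∈ K, ‖Ecι i z y‖ ≤ M)
    (hEcι : ∀ i ∈ s, ∀ z : ℂ, 2 < z.re → Ecι i z = eisensteinSeriesU (flatSectionU (ψ i) z))
      (Rι : ι → (quasiSplit (↥(maximalRealSubfield L)) L (IsCMField.complexConj L) 3).Adelic → ℂ)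
      (hRι : ∀ i ∈ s, ∀ y, Tendsto (fun z : ℂ => (z - (3 : ℂ) / 2) * (borelConstantTerm ν 𝓕 (Ecι i z) y - flatSectionU (ψ i) z y)) (𝓝[≠] ((3 : ℂ) / 2)) (𝓝 (Rι i y)))
    (hdec : ∀ (z : ℂ) (x : (quasiSplit (↥(maximalRealSubfield L)) L (IsCMField.complexConj L) 3).Adelic), flatSectionU φ z (x * g) = ∑ i ∈ s, (((c i : ℝ) : ℂ) ^ z) * flatSectionU (ψ i) z x)
    (x : (quasiSplit (↥(maximalRealSubfield L)) L (IsCMField.complexConj L) 3).Adelic) :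
    R (x * g) = ∑ i ∈ s, (((c i : ℝ) : ℂ) ^ ((3 : ℂ) / 2)) * Rι i x := by
  classical
  -- the right-hand side `(z − 3∕2)·Σᵢ cᵢ^z (…)ᵢ` tends to `Σᵢ cᵢ^{3/2} Rᵢ x`
  have hlim : Tendsto (fun z : ℂ => ∑ i ∈ s, (((c i : ℝ) : ℂ) ^ z) * ((z - (3 : ℂ) / 2) * (borelConstantTerm ν 𝓕 (Ecι i z) x - flatSectionU (ψ i) z x)))
      (𝓝[≠] ((3 : ℂ) / 2)) (𝓝 (∑ i ∈ s, (((c i : ℝ) : ℂ) ^ ((3 : ℂ) / 2)) * Rι i x)) := by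
    refine tendsto_finsetSum s fun i hi => ?_
    have hci : ((c i : ℝ) : ℂ) ≠ 0 := by exact_mod_cast (hc i hi).ne'
    exact (((continuousAt_const_cpow hci).tendsto).mono_left nhdsWithin_le_nhds).mul (hRι i hi x)
  -- eventually along `𝓝[≠] 3∕2` the two `(z − 3∕2)`-multiples agree (difference-form identity on the slit half-plane)
  have hev : (fun z : ℂ => (z - (3 : ℂ) / 2) * (borelConstantTerm ν 𝓕 (Ec z) (x * g) - flatSectionU φ z (x * g))) =ᶠ[𝓝[≠] ((3 : ℂ) / 2)]
      fun z => ∑ i ∈ s, (((c i : ℝ) : ℂ) ^ z) * ((z - (3 : ℂ) / 2) * (borelConstantTerm ν 𝓕 (Ecι i z) x - flatSectionU (ψ i) z x)) := by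
    filter_upwards [reSlit_mem_nhdsNE_three_halves (Sp ∪ s.biUnion Spι)] with z hz
    rw [ctSecondCoeff_translate_eq_sum L ξ μω hμu Ec Sp hSp hol hE4 hEbd hEc ν h𝓕N h𝓕c g s c hc ψ hψ hψc Ecι Spι hSpι holι hE4ι hEbdι hEcι hdec x z hz, Finset.mul_sum]
    exact Finset.sum_congr rfl fun i _ => by ring
  exact tendsto_nhds_unique ((hR (x * g)).congr' hev) hlim

/-- **`M₋₁(g·φ) = g·(M₋₁φ)` IN THE ℓ-CT LETTERS**: with the SHAPE letters `ψz`, `ψzι i` (★ `ctPackage_of_scalarRoad`, clause 1) and the residue letters `(z − 3∕2)·ψ_z(y) → ρψ(y)`,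
`(z − 3∕2)·ψᵢ_z(y) → ρψᵢ(y)` (clause 2), the residues satisfy `ρψ(x g)·H(x g)^{2 − 3/2} = Σᵢ cᵢ^{3/2}·ρψᵢ(x)·H(x)^{2 − 3/2}` — the currency `ρψ·H^{2−3/2}` of ★ p863422's package.
[cite: MoeglinWaldspurger1995, IV.1.9–IV.1.11] [cite: Langlands1976, §7] -/
theorem ctResidue_translate_eq_sum_of_letters (hμu : μω.IsUnitary)
    {φ : (quasiSplit (↥(maximalRealSubfield L)) L (IsCMField.complexConj L) 3).Adelic → ℂ} (Ec : ℂ → (quasiSplit (↥(maximalRealSubfield L)) L (IsCMField.complexConj L) 3).Adelic → ℂ) (Sp : Finset ℂ) (hSp : ∀ s ∈ Sp, s.im = 0 ∧ 1 < s.re ∧ s.re ≤ 2)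
      (hol : ∀ g, DifferentiableOn ℂ (fun z => Ec z g) ({z : ℂ | 1 < z.re} \ (↑Sp : Set ℂ)))
      (hE4 : ∀ z ∈ ({z : ℂ | 1 < z.re} \ (↑Sp : Set ℂ)), Continuous (Ec z))
      (hEbd : ∀ z₁ ∈ ({z : ℂ | 1 < z.re} \ (↑Sp : Set ℂ)), ∀ K : Set (quasiSplit (↥(maximalRealSubfield L)) L (IsCMField.complexConj L) 3).Adelic, IsCompact K → ∃ V ∈ 𝓝 z₁, ∃ M : ℝ, ∀ z ∈ V, ∀ g ∈ K, ‖Ec z g‖ ≤ M)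
      (hEc : ∀ z : ℂ, 2 < z.re → Ec z = eisensteinSeriesU (flatSectionU φ z))
    (ν : Measure ↥(adelicUnipotent (↥(maximalRealSubfield L)) L (IsCMField.complexConj L) 3)) [ν.IsHaarMeasure] {𝓕 : Set ↥(adelicUnipotent (↥(maximalRealSubfield L)) L (IsCMField.complexConj L) 3)}
      (h𝓕N : IsFundamentalDomain ↥(rationalUnipotent (↥(maximalRealSubfield L)) L (IsCMField.complexConj L) 3) 𝓕 ν) (h𝓕c : IsCompact (closure 𝓕))
      (ψz : ℂ → (quasiSplit (↥(maximalRealSubfield L)) L (IsCMField.complexConj L) 3).Adelic → ℂ)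
      (hct : ∀ z ∈ ({z : ℂ | 1 < z.re} \ (↑Sp : Set ℂ)), ∀ y : (quasiSplit (↥(maximalRealSubfield L)) L (IsCMField.complexConj L) 3).Adelic,
        borelConstantTerm ν 𝓕 (Ec z) y = φ y * (((borelHeight y : ℝ≥0) : ℝ) : ℂ) ^ z + ψz z y * (((borelHeight y : ℝ≥0) : ℝ) : ℂ) ^ (2 - z))
      (ρψ : (quasiSplit (↥(maximalRealSubfield L)) L (IsCMField.complexConj L) 3).Adelic → ℂ)
      (hρψ : ∀ y, Tendsto (fun z : ℂ => (z - (3 : ℂ) / 2) * ψz z y) (𝓝[≠] ((3 : ℂ) / 2)) (𝓝 (ρψ y)))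
    (g : (quasiSplit (↥(maximalRealSubfield L)) L (IsCMField.complexConj L) 3).Adelic) {ι : Type*} (s : Finset ι) (c : ι → ℝ≥0) (hc : ∀ i ∈ s, 0 < c i)
    (ψ : ι → (quasiSplit (↥(maximalRealSubfield L)) L (IsCMField.complexConj L) 3).Adelic → ℂ)
    (hψ : ∀ i ∈ s, ψ i ∈ chiSectionSpacePair (ξ.bcη⁻¹ * ξ.bcψ⁻¹ * μω) ξ.ψ (⊥ : Subgroup (quasiSplit (↥(maximalRealSubfield L)) L (IsCMField.complexConj L) 3).Adelic) ((1 : ↥(⊥ : Subgroup (quasiSplit (↥(maximalRealSubfield L)) L (IsCMField.complexConj L) 3).Adelic) →* ℂ) : ↥(⊥ : Subgroup (quasiSplit (↥(maximalRealSubfield L)) L (IsCMField.complexConj L) 3).Adelic) → ℂ))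
    (hψc : ∀ i ∈ s, Continuous (ψ i))
    (Ecι : ι → ℂ → (quasiSplit (↥(maximalRealSubfield L)) L (IsCMField.complexConj L) 3).Adelic → ℂ) (Spι : ι → Finset ℂ) (hSpι : ∀ i ∈ s, ∀ t ∈ Spι i, t.im = 0 ∧ 1 < t.re ∧ t.re ≤ 2)
    (holι : ∀ i ∈ s, ∀ y, DifferentiableOn ℂ (fun z => Ecι i z y) ({z : ℂ | 1 < z.re} \ (↑(Spι i) : Set ℂ)))
    (hE4ι : ∀ i ∈ s, ∀ z ∈ ({z : ℂ | 1 < z.re} \ (↑(Spι i) : Set ℂ)), Continuous (Ecι i z))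
    (hEbdι : ∀ i ∈ s, ∀ z₁ ∈ ({z : ℂ | 1 < z.re} \ (↑(Spι i) : Set ℂ)), ∀ K : Set (quasiSplit (↥(maximalRealSubfield L)) L (IsCMField.complexConj L) 3).Adelic, IsCompact K → ∃ V ∈ 𝓝 z₁, ∃ M : ℝ, ∀ z ∈ V, ∀ y ∈ K, ‖Ecι i z y‖ ≤ M)
    (hEcι : ∀ i ∈ s, ∀ z : ℂ, 2 < z.re → Ecι i z = eisensteinSeriesU (flatSectionU (ψ i) z))
      (ψzι : ι → ℂ → (quasiSplit (↥(maximalRealSubfield L)) L (IsCMField.complexConj L) 3).Adelic → ℂ)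
      (hctι : ∀ i ∈ s, ∀ z ∈ ({z : ℂ | 1 < z.re} \ (↑(Spι i) : Set ℂ)), ∀ y : (quasiSplit (↥(maximalRealSubfield L)) L (IsCMField.complexConj L) 3).Adelic,
        borelConstantTerm ν 𝓕 (Ecι i z) y = ψ i y * (((borelHeight y : ℝ≥0) : ℝ) : ℂ) ^ z + ψzι i z y * (((borelHeight y : ℝ≥0) : ℝ) : ℂ) ^ (2 - z))
      (ρψι : ι → (quasiSplit (↥(maximalRealSubfield L)) L (IsCMField.complexConj L) 3).Adelic → ℂ)
      (hρψι : ∀ i ∈ s, ∀ y, Tendsto (fun z : ℂ => (z - (3 : ℂ) / 2) * ψzι i z y) (𝓝[≠] ((3 : ℂ) / 2)) (𝓝 (ρψι i y)))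
    (hdec : ∀ (z : ℂ) (x : (quasiSplit (↥(maximalRealSubfield L)) L (IsCMField.complexConj L) 3).Adelic), flatSectionU φ z (x * g) = ∑ i ∈ s, (((c i : ℝ) : ℂ) ^ z) * flatSectionU (ψ i) z x)
    (x : (quasiSplit (↥(maximalRealSubfield L)) L (IsCMField.complexConj L) 3).Adelic) :
    ρψ (x * g) * (((borelHeight (x * g) : ℝ≥0) : ℝ) : ℂ) ^ (2 - (3 : ℂ) / 2) = ∑ i ∈ s, (((c i : ℝ) : ℂ) ^ ((3 : ℂ) / 2)) * (ρψι i x * (((borelHeight x : ℝ≥0) : ℝ) : ℂ) ^ (2 - (3 : ℂ) / 2)) := by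
  classical
  -- `z ↦ H(y)^{2−z}` is continuous (`H(y) > 0`)
  have hHc : ∀ y : (quasiSplit (↥(maximalRealSubfield L)) L (IsCMField.complexConj L) 3).Adelic,
      Tendsto (fun z : ℂ => (((borelHeight y : ℝ≥0) : ℝ) : ℂ) ^ (2 - z)) (𝓝[≠] ((3 : ℂ) / 2)) (𝓝 ((((borelHeight y : ℝ≥0) : ℝ) : ℂ) ^ (2 - (3 : ℂ) / 2))) := fun y => by
    have hH : (((borelHeight y : ℝ≥0) : ℝ) : ℂ) ≠ 0 := Complex.ofReal_ne_zero.2 (NNReal.coe_pos.2 (borelHeight_pos y)).ne'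
    have hcts : Continuous fun z : ℂ => (((borelHeight y : ℝ≥0) : ℝ) : ℂ) ^ (2 - z) := (continuous_const.sub continuous_id).const_cpow (Or.inl hH)
    exact (hcts.tendsto ((3 : ℂ) / 2)).mono_left nhdsWithin_le_nhds
  -- the residue letters are the `(z − 3∕2)`-limits of the difference forms
  have hR : ∀ y, Tendsto (fun z : ℂ => (z - (3 : ℂ) / 2) * (borelConstantTerm ν 𝓕 (Ec z) y - flatSectionU φ z y)) (𝓝[≠] ((3 : ℂ) / 2))
      (𝓝 (ρψ y * (((borelHeight y : ℝ≥0) : ℝ) : ℂ) ^ (2 - (3 : ℂ) / 2))) := fun y => by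
    refine ((hρψ y).mul (hHc y)).congr' ?_
    filter_upwards [reSlit_mem_nhdsNE_three_halves Sp] with z hz
    rw [hct z hz y, flatSectionU_apply, add_sub_cancel_left, mul_assoc]
  have hRι : ∀ i ∈ s, ∀ y, Tendsto (fun z : ℂ => (z - (3 : ℂ) / 2) * (borelConstantTerm ν 𝓕 (Ecι i z) y - flatSectionU (ψ i) z y)) (𝓝[≠] ((3 : ℂ) / 2))
      (𝓝 (ρψι i y * (((borelHeight y : ℝ≥0) : ℝ) : ℂ) ^ (2 - (3 : ℂ) / 2))) := fun i hi y => by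
    refine (((hρψι i hi y)).mul (hHc y)).congr' ?_
    filter_upwards [reSlit_mem_nhdsNE_three_halves (Spι i)] with z hz
    rw [hctι i hi z hz y, flatSectionU_apply, add_sub_cancel_left, mul_assoc]
  exact ctResidue_translate_eq_sum L ξ μω hμu Ec Sp hSp hol hE4 hEbd hEc ν h𝓕N h𝓕c _ hR g s c hc ψ hψ hψc Ecι Spι hSpι holι hE4ι hEbdι hEcι _ hRι hdec x

end Main

end Summit.HodgeConjecture.HodgeConjecture.R90.S8

end
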